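import Mathlib
import Summits.ResolutionOfSingularities.ResolutionOfSingularities.Theorems.FrobeniusLadderFRationalResolutionStalkPresentation
import HarnessLib

/-!
# Domain stalks of `k`-schemes locally of finite type are prime quotients of regular local rings

Route `FrobeniusLadder`, crux `FRationalResolution` (stmt-ResolutionOfSingularities-15317), line
`Sketch`, stub `exists_stalk_ringEquiv_regularLocal_quotient`: the presentation step that feeds
Hochster–Huneke 1994, Prop. 6.27 (a) (landed for rings `S ⧸ Q`, `S` regular local of
characteristic `p`, `Q` prime) with the stalks of `k`-schemes locally of finite type, `k` a field of
characteristic `p`. For `f : X → Spec k` locally of finite type and `x ∈ X` with `𝒪_{X,x}` a domain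
there is a regular local ring `S` of characteristic `p` and a prime ideal `Q ⊂ S` with
`𝒪_{X,x} ≃+* S ⧸ Q`.

Proof. By `exists_stalk_ringEquiv_quotient`, `𝒪_{X,x} ≃+* k[T₁, …, Tₙ]_P ⧸ Q` for a prime `P` of the
polynomial ring. Take `S = k[T]_P`: it is a regular local ring (Mathlib: polynomial rings over
regular rings are regular, `MvPolynomial.isRegularRing_of_isRegularRing`, and a field is regular),
of characteristic `p` (the structure map `k → S` is injective as `S` is nontrivial), and `Q` is prime
because `S ⧸ Q ≃ 𝒪_{X,x}` is a domain (`Ideal.Quotient.isDomain_iff_prime`). [folklore]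
-/

-- single-problem summit: the doubled namespace component is forced
set_option linter.dupNamespace false

noncomputable section

namespace Summit.ResolutionOfSingularities.ResolutionOfSingularities.Theorems.FRationalResolution

open CategoryTheory AlgebraicGeometry TopologicalSpace

/-- **Domain stalks of a `k`-scheme locally of finite type are prime quotients of regular local
rings of characteristic `p`.** For a field `k` of characteristic `p`, `f : X → Spec k` locally of
finite type and `x ∈ X` with `𝒪_{X,x}` a domain, there are a regular local ring `S` with
`CharP S p` and a prime ideal `Q` of `S` with `𝒪_{X,x} ≃+* S ⧸ Q`; concretely `S = k[T₁, …, Tₙ]_P`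
for a prime `P` of the polynomial ring (`exists_stalk_ringEquiv_quotient`). [folklore] -/
theorem exists_stalk_ringEquiv_regularLocal_quotient {p : ℕ} (hp : p.Prime) (k : Type) [Field k]
    [CharP k p] (X : Scheme.{0}) (f : X ⟶ Spec (.of k)) [LocallyOfFiniteType f] (x : X)
    [IsDomain (X.presheaf.stalk x)] :
    ∃ (S : Type) (_ : CommRing S) (_ : IsRegularLocalRing S) (_ : CharP S p) (Q : Ideal S)
      (_ : Q.IsPrime), Nonempty (X.presheaf.stalk x ≃+* S ⧸ Q) := by
  have _ := hp
  obtain ⟨n, P, hP, Q, ⟨e⟩⟩ := exists_stalk_ringEquiv_quotient k X f x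
  -- `S = k[T]_P` is a regular local ring: `k[T]` is a regular ring
  haveI : IsRegularLocalRing (Localization.AtPrime P) := inferInstance
  -- characteristic `p`: `k → k[T]_P` is injective (`k` a field, `k[T]_P` nontrivial)
  haveI : CharP (Localization.AtPrime P) p :=
    charP_of_injective_algebraMap (algebraMap k (Localization.AtPrime P)).injective p
  -- `Q` is prime: `k[T]_P ⧸ Q ≃ 𝒪_{X,x}` is a domain
  haveI : IsDomain (Localization.AtPrime P ⧸ Q) := MulEquiv.isDomain _ e.symm.toMulEquiv
  haveI : Q.IsPrime := (Ideal.Quotient.isDomain_iff_prime Q).mp inferInstance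
  exact ⟨Localization.AtPrime P, inferInstance, inferInstance, inferInstance, Q, inferInstance, ⟨e⟩⟩

end Summit.ResolutionOfSingularities.ResolutionOfSingularities.Theorems.FRationalResolution

end
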